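import Literature.NumberTheory.Automorphic.CongruenceSubgroupPropertySL2Proofs
import Mathlib.RingTheory.DedekindDomain.Factorization
import HarnessLib

/-!
# Serre's congruence subgroup property for `SL₂(𝓞_F)` — proofs, VII: Vaserstein's Lemma 1
# (`G(I₁, I₂) = G(I, I) E(I₁, I₂)`) over a Dedekind domain

Topic `Literature/NumberTheory/Automorphic`; namespace `Literature.NumberTheory.Automorphic.SL2Rel`.
Everything here is PROVED; no definitions, no named facts.

**Vaserstein 1972, Lemma 1** (= Liehl 1981, (1)): for non-zero ideals `I ⊆ I₁ ∩ I₂` of a Dedekind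
ring of arithmetic type, `G(I₁, I₂) = G(I, I) E(I₁, I₂)`.  Vaserstein and Liehl reduce modulo `I²`
to a finite (semi-local, principal ideal) ring.  We prove it for an arbitrary Dedekind domain `R`
(`SL2Rel.exists_mul_relE_mem_relG`) through the sharper `SL2Rel.exists_mul_relE_mem_Gamma`: for
`M ∈ G(I₁, I₂)` and any ideal `0 ≠ J ⊆ I₁` there is `E ∈ E(I₁, I₂)` with `M E ∈ Γ(J)`, by the same
row reduction carried out inside `R`: with `(a, b)` the first row of `M`,
* `z = (a - 1)t ∈ I₁I₂` with `a₁ = a + bz` prime to `J` (Liehl's (2); here by the Chinese remainder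
  theorem, `exists_add_mul_sup_eq_top`);
* `I₁ = (b₀) + J` (a Dedekind domain is "principal modulo `J`", Mathlib
  `IsDedekindDomain.exists_sup_span_eq`), and `x = r(b₀ - b) ∈ I₁`, `r a₁ ≡ 1 (mod J)`, moves `b` to
  `b₂ ≡ b₀ (mod J)`;
* `a₁ - 1 ∈ I₁I₂ = b₀I₂ + JI₂`, say `≡ b₀ s`, and `y = -s ∈ I₂` moves `a₁` to `a₃ ≡ 1 (mod J)`;
* `x' = -b₂` kills the upper right entry modulo `J`, and a last `E₂₁` the lower left one.

Also: the monotonicity of `E(I₁, I₂)`, `G(I₁, I₂)` in the ideals, `E(I₁, I₂) ≤ G(I₁, I₂)`, and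
`Γ(I²) ≤ G(I, I)`.

## References

* [Vaserstein1972SL2] L. N. Vaserstein, Mat. Sb. 89 (131) (1972) 313–322, Lemma 1 (p. 314, proof
  p. 317).
* [Liehl1981SL2Orders] B. Liehl, *On the group `SL₂` over orders of arithmetic type*, J. reine
  angew. Math. 323 (1981) 153–171, (1)–(2).
-/

open Matrix MatrixGroups

namespace Literature.NumberTheory.Automorphic

namespace SL2Rel

variable {R : Type*} [CommRing R]

/-! ### Bookkeeping: entries of `M E₁₂(x)`, `M E₂₁(y)`; monotonicity -/

/-- Entries of `M · E₁₂(x)`: the second column gets `x` times the first added. [folklore] -/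
theorem mul_e12_apply (M : SL(2, R)) (x : R) :
    (M * e12 x) 0 0 = M 0 0 ∧ (M * e12 x) 0 1 = M 0 1 + M 0 0 * x ∧
      (M * e12 x) 1 0 = M 1 0 ∧ (M * e12 x) 1 1 = M 1 1 + M 1 0 * x := by
  simp only [mul_apply_two, e12_apply_00, e12_apply_01, e12_apply_10, e12_apply_11]
  refine ⟨?_, ?_, ?_, ?_⟩ <;> ring

/-- Entries of `M · E₂₁(y)`: the first column gets `y` times the second added. [folklore] -/
theorem mul_e21_apply (M : SL(2, R)) (y : R) :
    (M * e21 y) 0 0 = M 0 0 + M 0 1 * y ∧ (M * e21 y) 0 1 = M 0 1 ∧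
      (M * e21 y) 1 0 = M 1 0 + M 1 1 * y ∧ (M * e21 y) 1 1 = M 1 1 := by
  simp only [mul_apply_two, e21_apply_00, e21_apply_01, e21_apply_10, e21_apply_11]
  refine ⟨?_, ?_, ?_, ?_⟩ <;> ring

/-- `ad - bc = 1` in `SL₂(R)`. [folklore] -/
theorem det_two (M : SL(2, R)) : M 0 0 * M 1 1 - M 0 1 * M 1 0 = 1 := by
  have h := M.prop
  rw [Matrix.det_fin_two] at h
  exact h

/-- The rows of a matrix in `SL₂(R)` are unimodular: `a` and `b` are coprime. [folklore] -/
theorem isCoprime_row (M : SL(2, R)) : IsCoprime (M 0 0) (M 0 1) :=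
  ⟨M 1 1, -M 1 0, by linear_combination det_two M⟩

/-- `E(I₁, I₂)` is monotone in the ideals. [cite: Vaserstein1972SL2, p. 313] -/
theorem relE_mono {I₁ I₂ I₁' I₂' : Ideal R} (h₁ : I₁ ≤ I₁') (h₂ : I₂ ≤ I₂') :
    relE I₁ I₂ ≤ relE I₁' I₂' :=
  Subgroup.closure_mono (Set.union_subset_union (Set.image_mono h₁) (Set.image_mono h₂))

/-- `G(I₁, I₂)` is monotone in the ideals. [cite: Vaserstein1972SL2, p. 313] -/
theorem relG_mono {I₁ I₂ I₁' I₂' : Ideal R} (h₁ : I₁ ≤ I₁') (h₂ : I₂ ≤ I₂') :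
    relG I₁ I₂ ≤ relG I₁' I₂' := by
  rintro M ⟨hb, hc, ha, hd⟩
  exact ⟨h₁ hb, h₂ hc, Ideal.mul_mono h₁ h₂ ha, Ideal.mul_mono h₁ h₂ hd⟩

/-- `E(I₁, I₂) ≤ G(I₁, I₂)`. [cite: Vaserstein1972SL2, p. 313] -/
theorem relE_le_relG (I₁ I₂ : Ideal R) : relE I₁ I₂ ≤ relG I₁ I₂ := by
  refine (Subgroup.closure_le _).2 ?_
  rintro M (⟨x, hx, rfl⟩ | ⟨y, hy, rfl⟩)
  · rw [SetLike.mem_coe] at hx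
    rw [SetLike.mem_coe, mem_relG]
    exact ⟨by simpa using hx, by simp, by simp, by simp⟩
  · rw [SetLike.mem_coe] at hy
    rw [SetLike.mem_coe, mem_relG]
    exact ⟨by simp, by simpa using hy, by simp, by simp⟩

/-- `Γ(I²) ≤ G(I, I)`. [cite: Vaserstein1972SL2, p. 314] -/
theorem Gamma_mul_self_le_relG (I : Ideal R) : Gamma (I * I) ≤ relG I I := by
  intro M hM
  rw [mem_Gamma] at hM
  exact ⟨Ideal.mul_le_right hM.1, Ideal.mul_le_right hM.2.1, hM.2.2.1, hM.2.2.2⟩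

/-- `Γ(J) ≤ Γ(J')` for `J ≤ J'`. [folklore] -/
theorem Gamma_mono {J J' : Ideal R} (h : J ≤ J') : Gamma J ≤ Gamma J' := by
  intro M hM
  rw [mem_Gamma] at hM ⊢
  exact ⟨h hM.1, h hM.2.1, h hM.2.2.1, h hM.2.2.2⟩

/-- The last step of the row reduction: if the first row of `M` is `≡ (1, 0) (mod J)` (and
`det M = 1`), then `M E₂₁(-c) ∈ Γ(J)`. [cite: Vaserstein1972SL2, p. 317] -/
theorem mul_e21_neg_mem_Gamma {J : Ideal R} (M : SL(2, R)) (ha : M 0 0 - 1 ∈ J) (hb : M 0 1 ∈ J) :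
    M * e21 (-(M 1 0)) ∈ Gamma J := by
  obtain ⟨h00, h01, h10, h11⟩ := mul_e21_apply M (-(M 1 0))
  have hd : M 1 1 - 1 ∈ J := by
    have : M 1 1 - 1 = -(M 1 1 * (M 0 0 - 1)) + M 0 1 * M 1 0 := by
      linear_combination det_two M
    rw [this]
    exact J.add_mem (J.neg_mem (J.mul_mem_left _ ha)) (J.mul_mem_right _ hb)
  rw [mem_Gamma, h00, h01, h10, h11]
  refine ⟨hb, ?_, ?_, hd⟩
  · have : M 1 0 + M 1 1 * -M 1 0 = -(M 1 0 * (M 1 1 - 1)) := by ring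
    rw [this]
    exact J.neg_mem (J.mul_mem_left _ hd)
  · have : M 0 0 + M 0 1 * -M 1 0 - 1 = (M 0 0 - 1) + -(M 0 1 * M 1 0) := by ring
    rw [this]
    exact J.add_mem ha (J.neg_mem (J.mul_mem_right _ hb))

/-! ### A Chinese remainder step in a Dedekind domain -/

section Dedekind

variable [IsDedekindDomain R]

open IsDedekindDomain

/-- **`a + tb` prime to `J`**: for `a, b` coprime and `J ≠ 0` there is `t` with `(a + tb) + J = R`
(make `a + tb ≡ 1` at the primes of `J` not containing `b`; at those containing `b`,
`a + tb ≡ a ∉ 𝔭`).  (Liehl's (2) for the semi-local ring `R/J`.) [folklore] -/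
theorem exists_add_mul_sup_eq_top {a b : R} (hab : IsCoprime a b) {J : Ideal R} (hJ : J ≠ ⊥) :
    ∃ t : R, Ideal.span {a + t * b} ⊔ J = ⊤ := by
  classical
  have hfin := Ideal.finite_factors (I := J) hJ
  set s : Finset (HeightOneSpectrum R) := hfin.toFinset with hs
  have hmem : ∀ v : HeightOneSpectrum R, v ∈ s ↔ J ≤ v.asIdeal := fun v ↦ by
    rw [hs, Set.Finite.mem_toFinset, Set.mem_setOf_eq, Ideal.dvd_iff_le]
  have hinv : ∀ v : HeightOneSpectrum R, b ∉ v.asIdeal → ∃ c : R, c * b - 1 ∈ v.asIdeal := by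
    intro v hb
    obtain ⟨c, i, hi, hci⟩ := v.isMaximal.exists_inv hb
    exact ⟨c, by rw [show c * b - 1 = -i by linear_combination hci]; exact v.asIdeal.neg_mem hi⟩
  choose! inv hinv using hinv
  let x : s → R := fun v ↦ if b ∈ v.1.asIdeal then 0 else (1 - a) * inv v.1
  obtain ⟨t, ht⟩ := IsDedekindDomain.exists_forall_sub_mem_ideal (s := s)
    (fun v : HeightOneSpectrum R ↦ v.asIdeal) (fun _ ↦ 1) (fun v _ ↦ v.prime)
    (fun v _ v' _ hvv' ↦ mt HeightOneSpectrum.ext hvv') x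
  have key : ∀ v : HeightOneSpectrum R, J ≤ v.asIdeal → a + t * b ∉ v.asIdeal := by
    intro v hJv
    have htv := ht v ((hmem v).mpr hJv)
    simp only [pow_one, x] at htv
    by_cases hbv : b ∈ v.asIdeal
    · rw [if_pos hbv, sub_zero] at htv
      intro h
      have : a ∈ v.asIdeal := by simpa using v.asIdeal.sub_mem h (v.asIdeal.mul_mem_left t hbv)
      exact Ideal.IsPrime.notMem_of_isCoprime_of_mem (I := v.asIdeal) hab.symm hbv this
    · rw [if_neg hbv] at htv
      intro h
      have h1 : a + t * b - 1 = (t - (1 - a) * inv v) * b + (1 - a) * (inv v * b - 1) := by ring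
      have h2 : a + t * b - 1 ∈ v.asIdeal := by
        rw [h1]
        exact v.asIdeal.add_mem (v.asIdeal.mul_mem_right _ htv)
          (v.asIdeal.mul_mem_left _ (hinv v hbv))
      have : (1 : R) ∈ v.asIdeal := by simpa using v.asIdeal.sub_mem h h2
      exact v.isMaximal.ne_top ((Ideal.eq_top_iff_one _).mpr this)
  refine ⟨t, ?_⟩
  by_contra hne
  obtain ⟨M, hM, hle⟩ := Ideal.exists_le_maximal _ hne
  have hJM : J ≤ M := le_sup_right.trans hle
  have hM0 : M ≠ ⊥ := fun h ↦ hJ (le_bot_iff.1 (h ▸ hJM))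
  exact key ⟨M, hM.isPrime, hM0⟩ hJM
    (hle (Ideal.mem_sup_left (Ideal.mem_span_singleton_self _)))

/-! ### Vaserstein's Lemma 1 -/

/-- **Row reduction modulo `J` inside `G(I₁, I₂)`** (the heart of Vaserstein's Lemma 1 / Liehl's
(1), carried out in `R` rather than in `R/J`): for `M ∈ G(I₁, I₂)` and an ideal `0 ≠ J ⊆ I₁` there
is `E ∈ E(I₁, I₂)` with `M E ∈ Γ(J)`.  See the module docstring for the four elementary moves.
[cite: Vaserstein1972SL2, Lemma 1 (proof, p. 317)] -/
theorem exists_mul_relE_mem_Gamma {I₁ I₂ J : Ideal R} (hJ : J ≠ ⊥) (hJI : J ≤ I₁)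
    {M : SL(2, R)} (hM : M ∈ relG I₁ I₂) : ∃ E ∈ relE I₁ I₂, M * E ∈ Gamma J := by
  have hEG := relE_le_relG I₁ I₂
  have hb : M 0 1 ∈ I₁ := hM.1
  have ha : M 0 0 - 1 ∈ I₁ * I₂ := hM.2.2.1
  -- Step 1: `z ∈ I₁ I₂` with `a₁ = a + b z` prime to `J`
  have hcop : IsCoprime (M 0 0) (M 0 1 * (M 0 0 - 1)) :=
    (isCoprime_row M).mul_right ⟨1, -1, by ring⟩
  obtain ⟨t, ht⟩ := exists_add_mul_sup_eq_top hcop hJ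
  obtain ⟨z, hz⟩ : ∃ z, z = (M 0 0 - 1) * t := ⟨_, rfl⟩
  have hzmem : z ∈ I₂ := by rw [hz]; exact I₂.mul_mem_right _ (Ideal.mul_le_left ha)
  obtain ⟨M₁, hM₁⟩ : ∃ M₁, M₁ = M * e21 z := ⟨_, rfl⟩
  have hM₁G : M₁ ∈ relG I₁ I₂ := hM₁ ▸ mul_mem hM (hEG (e21_mem_relE hzmem))
  obtain ⟨h₁00, h₁01, -, -⟩ := mul_e21_apply M z
  rw [← hM₁] at h₁00 h₁01
  have ha₁ : M 0 0 + t * (M 0 1 * (M 0 0 - 1)) = M₁ 0 0 := by rw [h₁00, hz]; ring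
  rw [ha₁] at ht
  obtain ⟨r, j, hj, hrj⟩ := Ideal.mem_span_singleton_sup.1 ((Ideal.eq_top_iff_one _).1 ht)
  -- `hrj : r * M₁ 0 0 + j = 1`
  have ha₁' : M₁ 0 0 - 1 ∈ I₁ * I₂ := by
    rw [h₁00, show M 0 0 + M 0 1 * z - 1 = (M 0 0 - 1) + M 0 1 * z by ring]
    exact Ideal.add_mem _ ha (Ideal.mul_mem_mul hb hzmem)
  -- Step 2: `I₁ = J + (b₀)`; `x = r (b₀ - b)` moves `b` to `b₂ ≡ b₀ (mod J)`
  obtain ⟨b₀, hb₀⟩ := IsDedekindDomain.exists_sup_span_eq hJI hJ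
  have hb₀I : b₀ ∈ I₁ := hb₀ ▸ Ideal.mem_sup_right (Ideal.mem_span_singleton_self b₀)
  obtain ⟨x, hx⟩ : ∃ x, x = r * (b₀ - M 0 1) := ⟨_, rfl⟩
  have hxmem : x ∈ I₁ := by rw [hx]; exact I₁.mul_mem_left _ (I₁.sub_mem hb₀I hb)
  obtain ⟨M₂, hM₂⟩ : ∃ M₂, M₂ = M₁ * e12 x := ⟨_, rfl⟩
  have hM₂G : M₂ ∈ relG I₁ I₂ := hM₂ ▸ mul_mem hM₁G (hEG (e12_mem_relE hxmem))
  obtain ⟨h₂00, h₂01, -, -⟩ := mul_e12_apply M₁ x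
  rw [← hM₂] at h₂00 h₂01
  rw [h₁01] at h₂01
  have hb₂ : M₂ 0 1 - b₀ ∈ J := by
    rw [h₂01, hx, show M 0 1 + M₁ 0 0 * (r * (b₀ - M 0 1)) - b₀ = -(j * (b₀ - M 0 1)) by
      linear_combination (b₀ - M 0 1) * hrj]
    exact J.neg_mem (J.mul_mem_right _ hj)
  have hb₂I : M₂ 0 1 ∈ I₁ := hM₂G.1
  -- Step 3: `a₁ - 1 ∈ I₁ I₂ = J I₂ + b₀ I₂`, `≡ b₀ s`; `y = -s` moves `a₁` to `a₃ ≡ 1 (mod J)`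
  have hdec : M₁ 0 0 - 1 ∈ J * I₂ ⊔ Ideal.span {b₀} * I₂ := by
    rw [← Ideal.sup_mul, hb₀]; exact ha₁'
  obtain ⟨j₂, hj₂, m, hm, hjm⟩ := Submodule.mem_sup.1 hdec
  obtain ⟨s, hs, rfl⟩ := Ideal.mem_span_singleton_mul.1 hm
  obtain ⟨M₃, hM₃⟩ : ∃ M₃, M₃ = M₂ * e21 (-s) := ⟨_, rfl⟩
  have hM₃G : M₃ ∈ relG I₁ I₂ := hM₃ ▸ mul_mem hM₂G (hEG (e21_mem_relE (I₂.neg_mem hs)))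
  obtain ⟨h₃00, h₃01, -, -⟩ := mul_e21_apply M₂ (-s)
  rw [← hM₃] at h₃00 h₃01
  have ha₃ : M₃ 0 0 - 1 ∈ J := by
    rw [h₃00, h₂00, show M₁ 0 0 + M₂ 0 1 * -s - 1 = (M₁ 0 0 - 1 - b₀ * s) + -((M₂ 0 1 - b₀) * s)
      by ring]
    refine J.add_mem ?_ (J.neg_mem (J.mul_mem_right _ hb₂))
    rw [← hjm, add_sub_cancel_right]
    exact Ideal.mul_le_right hj₂
  -- Step 4: `x' = -b₂` kills the upper right entry modulo `J`
  obtain ⟨M₄, hM₄⟩ : ∃ M₄, M₄ = M₃ * e12 (-(M₂ 0 1)) := ⟨_, rfl⟩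
  have hM₄G : M₄ ∈ relG I₁ I₂ := hM₄ ▸ mul_mem hM₃G (hEG (e12_mem_relE (I₁.neg_mem hb₂I)))
  obtain ⟨h₄00, h₄01, -, -⟩ := mul_e12_apply M₃ (-(M₂ 0 1))
  rw [← hM₄] at h₄00 h₄01
  have ha₄ : M₄ 0 0 - 1 ∈ J := by rw [h₄00]; exact ha₃
  have hb₄ : M₄ 0 1 ∈ J := by
    rw [h₄01, h₃01, show M₂ 0 1 + M₃ 0 0 * -M₂ 0 1 = -(M₂ 0 1 * (M₃ 0 0 - 1)) by ring]
    exact J.neg_mem (J.mul_mem_left _ ha₃)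
  -- Step 5: the lower left entry
  refine ⟨e21 z * e12 x * e21 (-s) * e12 (-(M₂ 0 1)) * e21 (-(M₄ 1 0)), ?_, ?_⟩
  · exact mul_mem (mul_mem (mul_mem (mul_mem (e21_mem_relE hzmem) (e12_mem_relE hxmem))
      (e21_mem_relE (I₂.neg_mem hs))) (e12_mem_relE (I₁.neg_mem hb₂I)))
      (e21_mem_relE (I₂.neg_mem hM₄G.2.1))
  · have : M * (e21 z * e12 x * e21 (-s) * e12 (-(M₂ 0 1)) * e21 (-(M₄ 1 0))) =
        M₄ * e21 (-(M₄ 1 0)) := by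
      rw [hM₄, hM₃, hM₂, hM₁]; simp only [mul_assoc]
    rw [this]
    exact mul_e21_neg_mem_Gamma M₄ ha₄ hb₄

/-- **Vaserstein 1972, Lemma 1** (Liehl 1981, (1)): for non-zero ideals `I ⊆ I₁ ∩ I₂` of a
Dedekind domain, `G(I₁, I₂) = G(I, I) E(I₁, I₂)`: every `M ∈ G(I₁, I₂)` is `M = A E⁻¹` with
`A = M E ∈ G(I, I)`, `E ∈ E(I₁, I₂)` (indeed `A ∈ Γ(I²)`; the hypothesis `I ⊆ I₂` is not needed).
[cite: Vaserstein1972SL2, Lemma 1] -/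
theorem exists_mul_relE_mem_relG {I I₁ I₂ : Ideal R} (hI : I ≠ ⊥) (hI₁ : I ≤ I₁)
    {M : SL(2, R)} (hM : M ∈ relG I₁ I₂) : ∃ E ∈ relE I₁ I₂, M * E ∈ relG I I := by
  obtain ⟨E, hE, hME⟩ := exists_mul_relE_mem_Gamma (J := I * I)
    (mul_ne_zero hI hI : I * I ≠ 0) (Ideal.mul_le_right.trans hI₁) hM
  exact ⟨E, hE, Gamma_mul_self_le_relG I hME⟩

end Dedekind

end SL2Rel

end Literature.NumberTheory.Automorphic
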